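import Mathlib
import HarnessLib
import Summits.ValiantsHypothesis.ValiantsHypothesis.Theses.MonotoneRestoration
import Literature.Computability.AlgebraicComplexity.ArithCircuit
import Literature.Computability.AlgebraicComplexity.ArithCircuitProofs
import Literature.Computability.AlgebraicComplexity.MonotoneStructure
import Literature.Computability.AlgebraicComplexity.PermanentIrreducible
import Literature.ModelTheory.FiniteModelTheory.CkEquiv
import Summits.ValiantsHypothesis.ValiantsHypothesis.Theorems.MonotoneRestorationMonotoneRestorationQPCosetCount
import Summits.ValiantsHypothesis.ValiantsHypothesis.Theorems.MonotoneRestorationMonotoneRestorationQPSymmetricLB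
import Summits.ValiantsHypothesis.ValiantsHypothesis.Theorems.MonotoneRestorationMonotoneRestorationQPSupportSymmetrisation
import Summits.ValiantsHypothesis.ValiantsHypothesis.Theorems.MonotoneRestorationMonotoneRestorationQPSparseRegime
import Summits.ValiantsHypothesis.ValiantsHypothesis.Theorems.MonotoneRestorationMonotoneRestorationQPBeta
import Literature.Computability.AlgebraicComplexity.SymmetricArithCircuit
import Literature.Computability.AlgebraicComplexity.DawarWilsenach2025Proofs
import Literature.GroupTheory.PermutationGroups.SmallIndexSubgroups
import Summits.ValiantsHypothesis.ValiantsHypothesis.Theorems.MonotoneRestorationQP.Negative.LoadBearing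
import Summits.ValiantsHypothesis.ValiantsHypothesis.Theorems.MonotoneRestorationMonotoneRestorationQPPermSupportCount

/-! TTRL-lite variant V19873 of stmt-ValiantsHypothesis-15886 -/

-- `Summit.ValiantsHypothesis.ValiantsHypothesis.…` is the tree's mandated single-conjunct layout
-- (Sub = Summit), so the duplicated namespace component is intended.
set_option linter.dupNamespace false

namespace Summit.ValiantsHypothesis.ValiantsHypothesis.Theorems

open Summit.ValiantsHypothesis.ValiantsHypothesis.Theses.MonotoneRestoration
open Literature.Computability.AlgebraicComplexity
open scoped Pointwise

/-- **TTRL-lite variant V19873 of `stub_mulGate_children_extend`** (sumset lower bound for the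
sparsity of a product over `ℝ≥0`): for nonzero `p q : MvPolynomial (Fin n × Fin n) ℝ≥0`,
`#supp p + #supp q ≤ #supp (p * q) + 1`.
Proof: over `ℝ≥0` nothing cancels, so the sumset `supp p + supp q` is contained in `supp (p * q)`
(`add_mem_support_mul`); the monomials `(Fin n × Fin n) →₀ ℕ` embed additively and injectively
(via `Nat.cast` on exponents) into the torsion-free group `(Fin n × Fin n) →₀ ℤ`, where the
Cauchy–Davenport inequality `#s + #t - 1 ≤ #(s + t)` holds
(`cauchy_davenport_of_isAddTorsionFree`). [folklore] -/
theorem stub_mulGate_children_extend_var19873 :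
    ∀ (n : ℕ) (p q : MvPolynomial (Fin n × Fin n) NNReal), p ≠ 0 → q ≠ 0 →
      p.support.card + q.support.card ≤ (p * q).support.card + 1 := by
  intro n p q hp hq
  classical
  -- no cancellation over `ℝ≥0`: the sumset of the supports lies in the support of the product
  have hsub : p.support + q.support ⊆ (p * q).support := by
    intro m hm
    obtain ⟨a, ha, b, hb, rfl⟩ := Finset.mem_add.mp hm
    exact add_mem_support_mul ha hb
  -- embed the monomials into the torsion-free group `(Fin n × Fin n) →₀ ℤ`
  let φ : ((Fin n × Fin n) →₀ ℕ) →+ ((Fin n × Fin n) →₀ ℤ) :=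
    Finsupp.mapRange.addMonoidHom (Nat.castAddMonoidHom ℤ)
  have hinj : Function.Injective φ :=
    Finsupp.mapRange_injective (Nat.cast : ℕ → ℤ) (Nat.cast_zero) Nat.cast_injective
  have hps : (p.support.image φ).Nonempty :=
    (MvPolynomial.support_nonempty.2 hp).image φ
  have hqs : (q.support.image φ).Nonempty :=
    (MvPolynomial.support_nonempty.2 hq).image φ
  have hcd := cauchy_davenport_of_isAddTorsionFree hps hqs
  rw [← Finset.image_add φ, Finset.card_image_of_injective _ hinj,
    Finset.card_image_of_injective _ hinj, Finset.card_image_of_injective _ hinj] at hcd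
  have hle := Finset.card_le_card hsub
  omega

end Summit.ValiantsHypothesis.ValiantsHypothesis.Theorems
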